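import Literature.AnabelianGeometry.SemiGraphs.TemperedDLocTypeTransportLemmas

/-!
# [SemiAnbd] Thm. 6.8 (ii), last clause — the [Mzk8] Cor. 2.5 mechanism: `α` preserves the decomposition groups of tempered `DLoc`-type, PROVED modulo named inputs

Mochizuki, *Semi-graphs of anabelioids* [SemiAnbd], §6 Thm. 6.8 (ii), kurims p. 74: "Moreover, `α`
preserves the decomposition groups of tempered `DLoc`-type"; printed proof (p. 75) = [Mzk8] (*Galois
sections in absolute anabelian geometry*) Cor. 2.5, ms. p. 9: "This follows immediately from the
definitions; Theorem 2.3 [and its proof]; Theorem 1.3, (ii), (iii)" (tempered rôles: Thm. 6.8 (i)(ii),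
Thm. 6.5 (ii), Thm. 6.5 (iii)). [cite: MochizukiSemiAnbd2006, Thm 6.8(ii) p.74]
[cite: MochizukiGalSect2005, Cor 2.5 p.9]

Proof-only companion (abc-iut cell, layer L3, seat abc-iut-w5-d040; sub-DAG row T68-B5 of
`plan/L3/SUBDAG-SemiAnbd-Thm68.md`) making that sentence kernel-explicit over abc-iut-L3-t4's
genuine-morphism category and transport (`TemperedDLocCategory.lean`, `TemperedDLocTransport.lean`):
`Thm68Sub.isoPreservesTemperedDLocType_of` derives `TemperedCurve.IsoPreservesTemperedDLocType X Y
DXs.toDLocContext DYs.toDLocContext α` from EXACTLY the named inputs — (i) for `Y_L` (essential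
surjectivity + fullness of the tempered-π₁ functor), the transport along `α` under (hI) = Thm. 6.5 (iii)
for cuspidal geometric decomposition groups and (hΔ), Thm. 6.5 (iii) for the curves underlying the
objects (`IsoPreservesCuspidalDecomp`), the tacit scheme-side fact T68-B4 (`CuspImageOpenInDecomp`) for
`Y_L`, compactness of decomposition groups (T68-B1) for `X_K` and `Y_L`, and Thm. 6.5 (ii)
(`DecompCommensurablyTerminal`) for `X_K` and `Y_L`.  Nothing of [SemiAnbd]/[Mzk8] is asserted; nothing
here takes a side on [IUTchIII] Cor. 3.12.
-/

noncomputable section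

namespace Literature.AnabelianGeometry.SemiGraphs

open scoped Pointwise
open CategoryTheory Topology

variable {p : ℕ} [Fact p.Prime]

namespace Thm68Sub

/-! ### The mechanism of [Mzk8] Cor. 2.5, kernel-explicit -/

section Main

variable {X Y : TemperedCurve p}

/-- **The transport of a `DLoc`-type witness** (the body of the [Mzk8] Cor. 2.5 argument, reusable for
Cor. 2.6/2.8): given a `DLoc`-type witness `(f : Z → X_K, D_z, γ)` for `x` and ANY object `Z'` of
`DLoc_L(Y_L)` whose tempered-π₁ object is isomorphic to the transport of that of `Z`, there are a
morphism `f' : Z' → Y_L` (fullness), a cuspidal decomposition group `D_{z'} = θ(D_z)` of `Π^temp_{Z'}`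
(Thm. 6.5 (iii)) and a point `y` of `Ȳ_L` (T68-B4) such that `(f', D_{z'})` is a `DLoc`-type witness
for `y` and `α(D_x)` is a conjugate of `D_y` (compactness T68-B1, Thm. 6.5 (ii), T68-B2).
[cite: MochizukiSemiAnbd2006, Thm 6.8(ii) p.74] [cite: MochizukiGalSect2005, Cor 2.5 p.9] -/
theorem exists_transported_witness (DXs : DLocSchemeData X) (DYs : DLocSchemeData Y)
    (α : X.PiTemp ≃ₜ* Y.PiTemp)
    (hI : ∀ I : Subgroup X.PiTemp, X.IsCuspidalGeometricDecompositionGroup I →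
      Y.IsCuspidalGeometricDecompositionGroup (I.map α.toMulEquiv.toMonoidHom))
    (hΔ : X.DeltaTemp.map α.toMulEquiv.toMonoidHom = Y.DeltaTemp)
    (hFull : PiFunctorFull Y DYs)
    (h65iii : ∀ (Z : DXs.DLocK) (Z' : DYs.DLocK),
      (DXs.curve Z).IsoPreservesCuspidalDecomp (DYs.curve Z'))
    (hB4 : CuspImageOpenInDecomp Y DYs) (hcX : DecompCompact X) (hcY : DecompCompact Y)
    (hctX : X.DecompCommensurablyTerminal) (hctY : Y.DecompCommensurablyTerminal)
    {x : X.Pt} {Z : DXs.DLocK} (f : letI := DXs.catK; Z ⟶ DXs.self)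
    (Dz : Subgroup (DXs.curve Z).PiTemp) (γ : ConjAct X.PiTemp)
    (hDz : (DXs.curve Z).IsCuspidalDecompositionGroup Dz)
    (hle : γ • (Dz.map (DXs.pi1 f).toMonoidHom).map DXs.selfIso.toMulEquiv.toMonoidHom ≤ X.decomp x)
    (hopen : IsOpen ((((γ • (Dz.map (DXs.pi1 f).toMonoidHom).map
      DXs.selfIso.toMulEquiv.toMonoidHom).subgroupOf (X.decomp x)) : Subgroup (X.decomp x)) :
        Set (X.decomp x)))
    {Z' : DYs.DLocK} (e : letI := DXs.catK; letI := DYs.catK; letI := DLocObj.dlocCategory X;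
      letI := DLocObj.dlocCategory Y;
      DYs.pi1Functor.obj Z' ≅ (DXs.pi1Functor.obj Z).transport α hI hΔ) :
    letI := DYs.catK
    ∃ (f' : Z' ⟶ DYs.self) (Dz' : Subgroup (DYs.curve Z').PiTemp) (γy : ConjAct Y.PiTemp) (y : Y.Pt),
      (DYs.curve Z').IsCuspidalDecompositionGroup Dz' ∧
      (γy • (Dz'.map (DYs.pi1 f').toMonoidHom).map DYs.selfIso.toMulEquiv.toMonoidHom ≤ Y.decomp y ∧
        IsOpen ((((γy • (Dz'.map (DYs.pi1 f').toMonoidHom).map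
          DYs.selfIso.toMulEquiv.toMonoidHom).subgroupOf (Y.decomp y)) : Subgroup (Y.decomp y)) :
            Set (Y.decomp y))) ∧
      ∃ γ' : ConjAct Y.PiTemp, (X.decomp x).map α.toMulEquiv.toMonoidHom = γ' • Y.decomp y := by
  letI := DXs.catK; letI := DYs.catK
  letI := DLocObj.dlocCategory X; letI := DLocObj.dlocCategory Y
  -- the three group-theoretic objects in play
  set A : DLocObj X := DXs.pi1Functor.obj Z with hA
  set A₀ : DLocObj X := DXs.pi1Functor.obj DXs.self with hA₀
  set B₀ : DLocObj Y := DYs.pi1Functor.obj DYs.self with hB₀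
  -- a representative of `π₁(f)` and its relation to `pi1 f`
  obtain ⟨φf, hφf, cf, hcf⟩ := DXs.map_objIso f
  -- a continuous isomorphism `J(obj Z') ⥲ J(A^α)` representing `e`
  obtain ⟨φ₁, θ₁, -, hθ₁⟩ := exists_equiv_of_iso e
  -- the transported `X_K`-object is (isomorphic through the identity of `J` to) the `Y_L`-object
  have hH0 : (A₀.transport α hI hΔ).H = B₀.H := by
    change A₀.H.map α.toMulEquiv.toMonoidHom = B₀.H
    rw [hA₀, hB₀, DXs.pi1Functor_self_H, DYs.pi1Functor_self_H,
      Subgroup.map_top_of_surjective _ α.surjective]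
  have hN0 : (A₀.transport α hI hΔ).N = B₀.N := by
    change A₀.N.map α.toMulEquiv.toMonoidHom = B₀.N
    have hgX : A₀.gens = ∅ := by rw [hA₀]; exact DXs.pi1Functor_self_gens
    have hgY : B₀.gens = ∅ := by rw [hB₀]; exact DYs.pi1Functor_self_gens
    exact map_N_eq_of_gens_empty α A₀ hgX B₀ hgY
  have hιaug : ∀ j, B₀.augJ (jEquivOfEq _ _ hH0 hN0 j) = (A₀.transport α hI hΔ).augJ j :=
    augJ_jEquivOfEq _ _ hH0 hN0
  -- the composite representative `J(obj Z') → J(B₀)` and a morphism `f' : Z' → Y_L` realising it (fullness)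
  obtain ⟨f', hf'⟩ := hFull.map_surjective
    (DLocObj.homMk ((DLocObj.HomRep.ofEquiv (jEquivOfEq _ _ hH0 hN0) hιaug).comp
      ((φf.transport α hI hΔ).comp φ₁)) : DYs.pi1Functor.obj Z' ⟶ B₀)
  obtain ⟨φ', hφ', c', hc'⟩ := DYs.map_objIso f'
  obtain ⟨b, hb⟩ := exists_conj_of_homMk_eq (hφ'.symm.trans hf')
  -- the isomorphism `Π^temp_Z ⥲ Π^temp_{Z'}` and the transported cuspidal decomposition group
  let θ : (DXs.curve Z).PiTemp ≃ₜ* (DYs.curve Z').PiTemp :=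
    ((DXs.objIso Z).symm.trans (DLocObj.jIso α hI hΔ A)).trans (θ₁.symm.trans (DYs.objIso Z'))
  have hDz' : (DYs.curve Z').IsCuspidalDecompositionGroup (Dz.map θ.toMulEquiv.toMonoidHom) :=
    ((h65iii Z Z') θ Dz).1 hDz
  -- the point `y` of `Ȳ_L` (T68-B4) and the `DLoc`-type witness for it
  obtain ⟨y, γy, hrestY⟩ := hB4 Z' f' _ hDz'
  refine ⟨f', Dz.map θ.toMulEquiv.toMonoidHom, γy, y, hDz', hrestY, ?_⟩
  -- ### the `α`-image of the open subgroup for `x` is a conjugate of the open subgroup for `y`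
  -- `σ_X : J(A₀) ⥲ Π^temp_{X_K}`, `σ_Y : J(B₀) ⥲ Π^temp_{Y_L}`
  have hσX : ∀ h : A₀.H, DXs.selfIso (DXs.objIso DXs.self (A₀.proj h)) = (h : X.PiTemp) :=
    DXs.selfIso_objIso
  have hσY : ∀ h : B₀.H, DYs.selfIso (DYs.objIso DYs.self (B₀.proj h)) = (h : Y.PiTemp) :=
    DYs.selfIso_objIso
  -- (⋆) `σ_Y ∘ ι ∘ j_{A₀} = α ∘ σ_X`
  have hstar : ∀ q : A₀.J, DYs.selfIso (DYs.objIso DYs.self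
      (jEquivOfEq _ _ hH0 hN0 (DLocObj.jIso α hI hΔ A₀ q))) =
        α (DXs.selfIso (DXs.objIso DXs.self q)) := by
    intro q
    obtain ⟨h, rfl⟩ := QuotientGroup.mk_surjective q
    change _ = α (DXs.selfIso (DXs.objIso DXs.self (A₀.proj h)))
    rw [hσX, DLocObj.jIso_mk]
    change DYs.selfIso (DYs.objIso DYs.self (jEquivOfEq _ _ hH0 hN0
      ((A₀.transport α hI hΔ).proj (DLocObj.subgroupIso α A₀.H h)))) = _
    rw [jEquivOfEq_mk, hσY]
    rfl
  -- elementwise description of the open subgroup for `x`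
  have hX : ∀ d : (DXs.curve Z).PiTemp,
      DXs.selfIso (DXs.pi1 f d) = (DXs.selfIso cf)⁻¹ *
        DXs.selfIso (DXs.objIso DXs.self (φf.toHom ((DXs.objIso Z).symm d))) * DXs.selfIso cf := by
    intro d
    have := hcf ((DXs.objIso Z).symm d)
    rw [ContinuousMulEquiv.apply_symm_apply] at this
    -- `this : objIso self (φf j) = cf * pi1 f d * cf⁻¹`
    have h2 : DXs.pi1 f d = cf⁻¹ * DXs.objIso DXs.self (φf.toHom ((DXs.objIso Z).symm d)) * cf := by
      rw [this]; group
    rw [h2, map_mul, map_mul, map_inv]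
  -- elementwise description of the open subgroup for `y`
  have hY : ∀ d : (DXs.curve Z).PiTemp,
      DYs.selfIso (DYs.pi1 f' (θ d)) = ((DYs.selfIso c')⁻¹ * (DYs.selfIso (DYs.objIso DYs.self b))⁻¹) *
        α (DXs.selfIso (DXs.objIso DXs.self (φf.toHom ((DXs.objIso Z).symm d)))) *
        ((DYs.selfIso c')⁻¹ * (DYs.selfIso (DYs.objIso DYs.self b))⁻¹)⁻¹ := by
    intro d
    -- `θ d = objIso Z' (θ₁⁻¹ (j_A (objIso Z⁻¹ d)))`
    set j := (DXs.objIso Z).symm d with hj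
    have hθd : θ d = DYs.objIso Z' (θ₁.symm (DLocObj.jIso α hI hΔ A j)) := rfl
    have h1 := hc' (θ₁.symm (DLocObj.jIso α hI hΔ A j))
    -- `h1 : objIso self (φ' j') = c' * pi1 f' (objIso Z' j') * c'⁻¹`
    have h2 : DYs.pi1 f' (θ d) =
        c'⁻¹ * DYs.objIso DYs.self (φ'.toHom (θ₁.symm (DLocObj.jIso α hI hΔ A j))) * c' := by
      rw [hθd, h1]; group
    -- `φ' j' = b⁻¹ · grep j' · b` and `grep j' = ι (j_{A₀} (φf j))`
    have h3 : φ'.toHom (θ₁.symm (DLocObj.jIso α hI hΔ A j)) =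
        b⁻¹ * jEquivOfEq _ _ hH0 hN0 (DLocObj.jIso α hI hΔ A₀ (φf.toHom j)) * b := by
      have := hb (θ₁.symm (DLocObj.jIso α hI hΔ A j))
      -- unfold the composite representative
      change (jEquivOfEq _ _ hH0 hN0) ((φf.transport α hI hΔ).toHom
        (φ₁.toHom (θ₁.symm (DLocObj.jIso α hI hΔ A j)))) = b * φ'.toHom _ * b⁻¹ at this
      rw [← hθ₁, ContinuousMulEquiv.apply_symm_apply, DLocObj.HomRep.transport_toHom_apply,
        ContinuousMulEquiv.symm_apply_apply] at this
      rw [this]; group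
    rw [h2, h3]
    simp only [map_mul, map_inv]
    rw [hstar]
    group
  -- the common "core" and the two conjugating elements
  set uX : X.PiTemp := ConjAct.ofConjAct γ * (DXs.selfIso cf)⁻¹ with huX
  set uY : Y.PiTemp := ConjAct.ofConjAct γy *
    ((DYs.selfIso c')⁻¹ * (DYs.selfIso (DYs.objIso DYs.self b))⁻¹) with huY
  set κ : Y.PiTemp := uY * (α uX)⁻¹ with hκ
  let F : X.PiTemp ≃ₜ* Y.PiTemp := α.trans (conjCME κ)
  -- the two open subgroups
  set UX : Subgroup X.PiTemp :=
    γ • (Dz.map (DXs.pi1 f).toMonoidHom).map DXs.selfIso.toMulEquiv.toMonoidHom with hUX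
  set UY : Subgroup Y.PiTemp := γy • ((Dz.map θ.toMulEquiv.toMonoidHom).map
    (DYs.pi1 f').toMonoidHom).map DYs.selfIso.toMulEquiv.toMonoidHom with hUY
  have hleY : UY ≤ Y.decomp y := hrestY.1
  have hopenY : IsOpen ((UY.subgroupOf (Y.decomp y) : Subgroup (Y.decomp y)) : Set (Y.decomp y)) :=
    hrestY.2
  -- KEY IDENTITY: `F(U_X) = U_Y`
  have hF : ∀ z, F z = κ * α z * κ⁻¹ := fun z => rfl
  have hkey : UX.map F.toMulEquiv.toMonoidHom = UY := by
    ext z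
    constructor
    · rintro ⟨w, hw, rfl⟩
      obtain ⟨w₀, hw₀, rfl⟩ := (Subgroup.mem_smul_pointwise_iff_exists _ _ _).1 hw
      obtain ⟨_, ⟨d, hd, rfl⟩, rfl⟩ := hw₀
      refine (Subgroup.mem_smul_pointwise_iff_exists _ _ _).2
        ⟨DYs.selfIso (DYs.pi1 f' (θ d)), ⟨_, ⟨_, ⟨d, hd, rfl⟩, rfl⟩, rfl⟩, ?_⟩
      change ConjAct.ofConjAct γy * DYs.selfIso (DYs.pi1 f' (θ d)) * (ConjAct.ofConjAct γy)⁻¹ =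
        F (ConjAct.ofConjAct γ * DXs.selfIso (DXs.pi1 f d) * (ConjAct.ofConjAct γ)⁻¹)
      rw [hF, hY d, hX d, hκ, huY, huX]
      simp only [map_mul, map_inv]
      group
    · intro hz
      obtain ⟨w, hw, rfl⟩ := (Subgroup.mem_smul_pointwise_iff_exists _ _ _).1 hz
      obtain ⟨_, ⟨_, ⟨d, hd, rfl⟩, rfl⟩, rfl⟩ := hw
      refine ⟨ConjAct.ofConjAct γ * DXs.selfIso (DXs.pi1 f d) * (ConjAct.ofConjAct γ)⁻¹, ?_, ?_⟩
      · exact (Subgroup.mem_smul_pointwise_iff_exists _ _ _).2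
          ⟨DXs.selfIso (DXs.pi1 f d), ⟨_, ⟨d, hd, rfl⟩, rfl⟩, rfl⟩
      · change F _ = ConjAct.ofConjAct γy * DYs.selfIso (DYs.pi1 f' (θ d)) * (ConjAct.ofConjAct γy)⁻¹
        rw [hF, hY d, hX d, hκ, huY, huX]
        simp only [map_mul, map_inv]
        group
  -- finite index of `U_Y` in `F(D_x)` and in `D_y` (compactness), commensurable terminality of both
  have hleF : UY ≤ (X.decomp x).map F.toMulEquiv.toMonoidHom := hkey ▸ Subgroup.map_mono hle
  have hfiF : (UY.subgroupOf ((X.decomp x).map F.toMulEquiv.toMonoidHom)).FiniteIndex := by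
    rw [← hkey]
    exact finiteIndex_subgroupOf_of_isOpen (isCompact_map F (hcX x)) (isOpen_subgroupOf_map F hopen)
  have hfiY : (UY.subgroupOf (Y.decomp y)).FiniteIndex :=
    finiteIndex_subgroupOf_of_isOpen (hcY y) hopenY
  have hctF : Subgroup.Commensurable.commensurator ((X.decomp x).map F.toMulEquiv.toMonoidHom) =
      (X.decomp x).map F.toMulEquiv.toMonoidHom := commensurator_map_eq F.toMulEquiv (hctX x)
  have h1 : (X.decomp x).map F.toMulEquiv.toMonoidHom ≤ Y.decomp y :=
    le_of_finiteIndex_le_of_commensurator_eq hleF hfiF hleY hfiY (hctY y)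
  have h2 : Y.decomp y ≤ (X.decomp x).map F.toMulEquiv.toMonoidHom :=
    le_of_finiteIndex_le_of_commensurator_eq hleY hfiY hleF hfiF hctF
  have hEq : (X.decomp x).map F.toMulEquiv.toMonoidHom = Y.decomp y := le_antisymm h1 h2
  -- `F(D_x) = κ • α(D_x)`
  have hFmap : (X.decomp x).map F.toMulEquiv.toMonoidHom =
      ConjAct.toConjAct κ • (X.decomp x).map α.toMulEquiv.toMonoidHom := by
    rw [← map_conjCME, Subgroup.map_map]
    rfl
  refine ⟨(ConjAct.toConjAct κ)⁻¹, ?_⟩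
  rw [← hEq, hFmap, inv_smul_smul]


/-- **T68-B5 PROVED modulo named inputs** — [SemiAnbd] Thm. 6.8 (ii), last clause ("`α` preserves the
decomposition groups of tempered `DLoc`-type"), by the argument of [Mzk8] Cor. 2.5 ("immediately from
the definitions; Theorem 2.3 [and its proof]; Theorem 1.3, (ii), (iii)"): transport the `DLoc`-type
witness of `x` (`exists_transported_witness`), the object `Z'` being supplied by essential surjectivity of
the tempered-π₁ functor of `Y_L` (Thm. 6.8 (i)).  Every input is a NAMED hypothesis; nothing of
[SemiAnbd]/[Mzk8] is asserted. [cite: MochizukiSemiAnbd2006, Thm 6.8(ii) p.74]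
[cite: MochizukiGalSect2005, Cor 2.5 p.9] -/
theorem isoPreservesTemperedDLocType_of (DXs : DLocSchemeData X) (DYs : DLocSchemeData Y)
    (α : X.PiTemp ≃ₜ* Y.PiTemp)
    (hI : ∀ I : Subgroup X.PiTemp, X.IsCuspidalGeometricDecompositionGroup I →
      Y.IsCuspidalGeometricDecompositionGroup (I.map α.toMulEquiv.toMonoidHom))
    (hΔ : X.DeltaTemp.map α.toMulEquiv.toMonoidHom = Y.DeltaTemp)
    (hEss : PiFunctorEssSurj Y DYs) (hFull : PiFunctorFull Y DYs)
    (h65iii : ∀ (Z : DXs.DLocK) (Z' : DYs.DLocK),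
      (DXs.curve Z).IsoPreservesCuspidalDecomp (DYs.curve Z'))
    (hB4 : CuspImageOpenInDecomp Y DYs) (hcX : DecompCompact X) (hcY : DecompCompact Y)
    (hctX : X.DecompCommensurablyTerminal) (hctY : Y.DecompCommensurablyTerminal) :
    X.IsoPreservesTemperedDLocType Y DXs.toDLocContext DYs.toDLocContext α := by
  letI := DXs.catK; letI := DYs.catK
  letI := DLocObj.dlocCategory X; letI := DLocObj.dlocCategory Y
  intro x hx
  obtain ⟨Z, f, Dz, γ, hDz, hrest⟩ := hx
  change DXs.DLocK at Z
  change Z ⟶ DXs.self at f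
  change Subgroup (DXs.curve Z).PiTemp at Dz
  change (DXs.curve Z).IsCuspidalDecompositionGroup Dz at hDz
  -- an object `Z'` of `DLoc_L(Y_L)` realising the transport (essential surjectivity, (i) for `Y`)
  obtain ⟨Z', ⟨e⟩⟩ := hEss.mem_essImage ((DXs.pi1Functor.obj Z).transport α hI hΔ)
  obtain ⟨f', Dz', γy, y, hDz', hrestY, hconj⟩ := exists_transported_witness DXs DYs α hI hΔ hFull
    h65iii hB4 hcX hcY hctX hctY f Dz γ hDz hrest.1 hrest.2 e
  exact ⟨y, ⟨Z', f', Dz', γy, hDz', hrestY⟩, hconj⟩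

end Main

end Thm68Sub

end Literature.AnabelianGeometry.SemiGraphs

end
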